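import Summits.QuantumFields.YangMills.Theorems.UnitScaleTiltProp7OneFormGreenKernelRow
import Summits.QuantumFields.YangMills.Theorems.UnitScaleTiltProp7MemberCoshWeightRate
import HarnessLib

/-!
# Route `UnitScaleTilt`, crux K1 «MinimiserStabilityRegPr» (stmt-QuantumFields-19200), EX face S46 — (L3′b)-VALUE, ONE-FORM STOREY, FILE (RATE):
# **THE `_rate` EDITIONS — O4-KNIT, O4-E2E AND (K2) AT THE EXPLICIT, K-FREE RATE `κ₁ := min r (1∕4) ∕ 2` DISPLAYED BEFORE THE MEMBER** (cst-p1 g35's RATE-FLOOR root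
# ✓`Prop7MemberCoshWeightRate.exists_coshFamily_rate` in place of O4b's `∃ κ`)

Cell `ym3-torus` (HUMAN RULING D-0037; rung R3 = SU(2) YM₃ on T³ — NOT d = 4, NOT infinite volume, NOT a mass gap, NOT Clay).  Width seat `ym3-torus-px16` g13 on cst-p1 g35's 08:51:48Z flag
(`--supports stmt-QuantumFields-19200 --as helper`).  THEOREMS ONLY (0 `def`, 0 `sorry`); count-neutral.

WHY.  ★p1 g26's ✓`pointwiseDecay_oneForm_knit` ∕ ✓`pointwiseDecay_oneForm_DeltaEtaSlot` and px16's ✓`kernelRow_GT_DeltaEtaSlot` export the decay rate as a bare `∃ κ₁ ∈ (0, r]` chosen AFTER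
the member `(F, n, K, U₀)` (and, for E2E, after the source): TRUE but K-SILENT — the witness behind O4b's ✓`exists_coshFamily` is lit's `a = min 1 (1∕(24ℓ²+4))`, i.e. a block rate
`≈ 1∕(24ℓ) → 0`.  cst-p1 g35's root ✓`exists_coshFamily_rate (hμ₀ : 0 < μ₀) (hμ₀4 : μ₀ ≤ 1∕4)` builds the SAME cosh family at the explicit block rate `μ₀`.  THIS FILE re-runs the three
proofs on that root with `μ₀ := min r (1∕4)`, `κ₁ := μ₀∕2` — the rate now stands IN THE STATEMENT, before the member, K-free; the constants are the landed ones (they only used `κ ≤ r`).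
WHAT IS PROVED (ns `Summit.QuantumFields.YangMills.Theorems.Prop7OneFormPointwiseDecayRate`).
* §1 ★★★ `pointwiseDecay_oneForm_knit_rate` — the KNIT with conclusion `∀ p₀, ‖u(p₀)‖ ≤ A_r·e^{−(min r (1∕4)∕2)·d(p₀)}` (no `∃`), its `hqdom` letter asked ONLY at that rate
  (re-derivation of ✓`Prop7OneFormPointwiseDecayKnit.pointwiseDecay_oneForm_knit`, ★p1 g26, credit: proof text his, rate binder moved).
* §2 ★★★ `pointwiseDecay_oneForm_DeltaEtaSlot_rate` — E2E at that rate (re-derivation of ✓`Prop7OneFormPointwiseDecayE2E.pointwiseDecay_oneForm_DeltaEtaSlot`, ★p1 g26; `hqdom` by px16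
  ✓`hqdom_of_letters`).
* §3 ★★★ `kernelRow_GT_DeltaEtaSlot_rate` — (K2) at that rate: `∀ b Z bd, ‖toL2⁻¹(G₀(toL2 δ_bZ)) bd‖ ≤ (√2·A₁)·e^{−(min r (1∕4)∕2)·tdist(B b₋, B bd₋)}·‖Z‖` — O4e's `hk` text with the
  RATE DISPLAYED; the finite-minimum device of (K2) drops out (§2 applies source by source at one rate), and the constant improves `4√2 → √2` (homogeneity of E2E's constant in `(Fsrc, D₀)`).
HONEST SCOPE.  Re-derivations; CONDITIONAL on the same displayed letters as the originals ((γ)(C_V)(θ_V-class) ∕ `hD`, `hkD`, `hkQ`, `PosOnto`, `RegPr`); nothing of the EX rows, EX or the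
crux is proved; no summit is proved by a helper.

References: T. Bałaban, CMP **99** (1985) 389–434 [Balaban1985BackgroundPropagators] (Thm 3.1 (3.42) p.397 «constants dependent on d and L only», (3.46) p.398, (3.49) p.399,
Thm 3.12 p.422); CMP **95** (1984) 17–40 [Balaban1984PropagatorsI] (Prop. 1.1 p.33, p.36).
-/

set_option autoImplicit false

noncomputable section

open scoped Matrix.Norms.L2Operator BigOperators InnerProductSpace ComplexConjugate

namespace Summit.QuantumFields.YangMills.Theorems.Prop7OneFormPointwiseDecayRate

open Literature.MathematicalPhysics.QuantumFieldTheory.Balaban1983to89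
open Literature.MathematicalPhysics.QuantumFieldTheory.Balaban1983to89.T3ContinuumYM3Torus
open Literature.MathematicalPhysics.QuantumFieldTheory.Balaban1983to89.T3PrintedRegularMinimiser (RegPr)
open T3SectALandauChart (formComp bgUnits eta eta_pos)
open B4Sect5Torus (TSite)
open B9SectCLatticeCarrier (Bond shift unshift)
open B9Eq311L2Pairing (WL2)
open B9TorusCalculus (torusT)
open B9Eq310Hermitian (deltaPrimeOp)
open B11Eq135Weitzenbock (curvOp)
open B11Eq103H1Complex (BondL2K)
open B5Eq118OneStroke (iterBlockOf)
open B3Taylor310LocalRemainder (tdist_self tdist_comm)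
open Summit.QuantumFields.YangMills.Theorems.Prop7SectET3Transport (periodsT3 siteEquiv bondEquiv)
open Summit.QuantumFields.YangMills.Theorems.Prop7SectET3HilbertLetters (W₂ frobEquiv toL2 toL2S DL2 DstarL2 toL2_symm_apply)
open Summit.QuantumFields.YangMills.Theorems.Prop7SectET3WilsonHessian (DeltaEta DeltaEtaSlot)
open Summit.QuantumFields.YangMills.Theorems.Prop7SectET3GaugeProjector (RS)
open Summit.QuantumFields.YangMills.Theorems.Prop7SectET3CurvedPropagators (laplaceA Qk GT PosOnto laplaceA_GT)
open Summit.QuantumFields.YangMills.Theorems.Prop7RieszTauFrobNorm (norm_frobEquiv_le norm_frobEquiv_symm_le)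
open Summit.QuantumFields.YangMills.Theorems.Prop7OneFormPointwiseDecay (pointwiseDecay_oneForm_of_letters)
open Summit.QuantumFields.YangMills.Theorems.Prop7OneFormPointwiseDecayKnit (sum_range_three_inv_pow_le)
open Summit.QuantumFields.YangMills.Theorems.Prop7OneFormDecayData (norm_le_mul_exp_neg_of_support sqrt_sum_normSq_div_weight_le_of_blockDecay)
open Summit.QuantumFields.YangMills.Theorems.Prop7OneFormPointwiseDecayE2E (norm_equiv_apply_le_of_kernelRow_blockDecay)
open Summit.QuantumFields.YangMills.Theorems.Prop7OneFormLocalRemainderDecay (hqdom_of_letters blockDist_le_blockDist_add_five)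
open Summit.QuantumFields.YangMills.Theorems.Prop7OneFormBlockDecayAll (blockDecay_allBlocks_of_letters eta_sq_exp_sub_one_sq_le)
open Summit.QuantumFields.YangMills.Theorems.Prop7OneFormGreenKernelRow (norm_toL2_pi_single norm_equiv_toL2_pi_single_le iterBlockOf_eq_of_equiv_toL2_pi_single_ne_zero)
open Summit.QuantumFields.YangMills.Theorems.Prop7MemberCoshWeightRate (exists_coshFamily_rate)

variable {F : T3Family} {n K : ℕ} {c₀ : ℝ} [Fact (0 < c₀)] {h : n ≤ K} {cB a : ℝ} [Fact (0 < cB)]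
  {Δx : GaugeField (F.P K) 0 (Matrix.specialUnitaryGroup (Fin 2) ℂ) → (BondL2K ℂ 3 (periodsT3 F K) c₀ W₂ →ₗ[ℂ] BondL2K ℂ 3 (periodsT3 F K) c₀ W₂)}

/-! ## §1 The KNIT at the explicit rate `min r (1∕4) ∕ 2` -/

set_option maxHeartbeats 400000 in
/-- ★★★ **THE POINTWISE DECAY OF THE ONE-FORM GREEN's FUNCTION AT THE EXPLICIT RATE `κ₁ := min r (1∕4) ∕ 2`.**  Same letters as ✓`pointwiseDecay_oneForm_knit` (block-supported bounded
source, A4-shape `L²` block decay `hD` at rate `r > 0`, smallness `θ·(8e^{3r})·14 < 1`), the remainder letter `hqdom` asked ONLY at the rate `κ₁`; conclusion WITHOUT `∃`: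
`‖u(p₀)‖ ≤ A_r·e^{−κ₁·tdist(B(p₀), v)}` at every bond, `A_r` the KNIT's constant.  O4 on cst-p1's cosh family at block rate `μ₀ := min r (1∕4)` (✓`exists_coshFamily_rate`), `κ₁ = μ₀∕2`.
Re-derivation of ★p1 g26's proof (rate binder moved in front of the member).  CONDITIONAL on the displayed letters.  HEARTBEATS (disclosed): decl-local `400000` as for the
KNIT it re-derives (px16 g13 measured the KNIT between 100k and 130k; this copy likewise fails at 100k); the mathematics is unaffected.
[cite: Balaban1985BackgroundPropagators, Thm 3.1 (3.42) p.397, (3.46) p.398, Thm 3.12 p.422; Balaban1984PropagatorsI, Prop. 1.1 p.33] -/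
theorem pointwiseDecay_oneForm_knit_rate (hnK : n ≤ K) (U₀ : GaugeField (F.P K) 0 (Matrix.specialUnitaryGroup (Fin 2) ℂ))
    {u f : BondL2K ℂ 3 (periodsT3 F K) c₀ W₂} (hu : laplaceA F n K h c₀ cB a Δx U₀ u = f)
    {q : Bond 3 (periodsT3 F K) → W₂}
    (hq : ∀ p, q p = WL2.equiv ℂ _ W₂ (LinearMap.adjoint (Qk F n K h c₀ cB U₀) (((a : ℝ) : ℂ) • Qk F n K h c₀ cB U₀ u)) p
      - WL2.equiv ℂ _ W₂ (DL2 F n K c₀ U₀ (DstarL2 F n K c₀ U₀ u - RS F n K h c₀ cB U₀ (DstarL2 F n K c₀ U₀ u))) p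
      + WL2.equiv ℂ _ W₂ ((Δx U₀ - (DeltaEta F n K c₀ U₀ : BondL2K ℂ 3 (periodsT3 F K) c₀ W₂ →ₗ[ℂ] BondL2K ℂ 3 (periodsT3 F K) c₀ W₂)) u) p
      + frobEquiv.symm ((eta F n K)⁻¹ • (eta F n K)⁻¹ •
          (deltaPrimeOp (torusT (F.P K) 0) (fun ν x => bgUnits F K U₀ ⟨x, ν⟩) 1 (formComp ((toL2 F K c₀).symm u)) p.2 ((siteEquiv F K).symm p.1)
            - curvOp (torusT (F.P K) 0) (fun ν x => bgUnits F K U₀ ⟨x, ν⟩) (formComp ((toL2 F K c₀).symm u)) p.2 ((siteEquiv F K).symm p.1))))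
    (v : Site (F.P K) (K - n)) {Fsrc : ℝ} (hfb : ∀ p, ‖WL2.equiv ℂ _ W₂ f p‖ ≤ Fsrc)
    (hfs : ∀ p, WL2.equiv ℂ _ W₂ f p ≠ 0 → iterBlockOf (K - n) ((bondEquiv F K).symm p).src = v)
    {r D₀ : ℝ} (hr : 0 < r) (hD₀ : 0 ≤ D₀)
    (hD : ∀ y : Site (F.P K) (K - n),
      ‖toL2 F K c₀ (fun b => if iterBlockOf (K - n) b.src = y then (toL2 F K c₀).symm u b else 0)‖ ≤ D₀ * Real.exp (-(r * (Site.tdist y v : ℝ))))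
    {sD θ : ℝ} (hsD : 0 ≤ sD) (hθ : 0 ≤ θ)
    (hqdom : ∀ p, ‖q p‖
      ≤ (sD + θ * ⨆ p', ‖WL2.equiv ℂ _ W₂ u p'‖ * Real.exp ((min r (1 / 4) / 2) * (Site.tdist (iterBlockOf (K - n) ((bondEquiv F K).symm p').src) v : ℝ)))
          * Real.exp (-((min r (1 / 4) / 2) * (Site.tdist (iterBlockOf (K - n) ((bondEquiv F K).symm p).src) v : ℝ))))
    (hsmall : θ * (8 * Real.exp (3 * r)) * 14 < 1) (p₀ : Bond 3 (periodsT3 F K)) :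
    ‖WL2.equiv ℂ _ W₂ u p₀‖
      ≤ (((Fsrc + sD) * (8 * Real.exp (3 * r)) * 14
            + Real.sqrt (3 ^ 3 * 8 / (c₀ * ((F.L : ℝ) ^ (K - n)) ^ 3)) * (Real.sqrt (8 * Real.exp (3 * r) * (2 * (1 + 1 / r)) ^ 3) * D₀))
          / (1 - θ * (8 * Real.exp (3 * r)) * 14))
        * Real.exp (-((min r (1 / 4) / 2) * (Site.tdist (iterBlockOf (K - n) ((bondEquiv F K).symm p₀).src) v : ℝ))) := by
  have hc₀ : 0 < c₀ := Fact.out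
  -- the cosh family at the explicit block rate `μ₀ := min r (1∕4)`
  set κ : ℝ := min r (1 / 4) with hκdef
  have hκ0 : 0 < κ := lt_min hr (by norm_num)
  have hκr : κ ≤ r := min_le_left _ _
  have hκ4 : κ ≤ 1 / 4 := min_le_right _ _
  obtain ⟨lam, W, hlam, hWpos, hsup, hW1, hfloor, hgrowth⟩ := exists_coshFamily_rate F n K hnK hκ0 hκ4 v
  have hlam0 : 0 < lam := by linarith
  set d : Bond 3 (periodsT3 F K) → ℝ := fun p => (Site.tdist (iterBlockOf (K - n) ((bondEquiv F K).symm p).src) v : ℝ) with hd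
  set κ₁ : ℝ := κ / 2 with hκ₁
  have hκ₁0 : 0 < κ₁ := by positivity
  have hκ₁κ : κ₁ ≤ κ := by rw [hκ₁]; linarith
  have hFsrc : 0 ≤ Fsrc := (norm_nonneg _).trans (hfb p₀)
  have hf' : ∀ p, ‖WL2.equiv ℂ _ W₂ f p‖ ≤ Fsrc * Real.exp (-(κ₁ * d p)) :=
    norm_le_mul_exp_neg_of_support (fun p => WL2.equiv ℂ _ W₂ f p) d κ₁ hfb fun p hp => by
      show (Site.tdist (iterBlockOf (K - n) ((bondEquiv F K).symm p).src) v : ℝ) = 0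
      rw [hfs p hp, tdist_self]; simp
  have hWd : ∀ p₁ p, Real.exp (κ₁ * d p₁) ≤ (8 * Real.exp (3 * κ)) * Real.exp (κ₁ * d p) * W p₁ p := hgrowth κ₁ hκ₁0.le hκ₁κ
  set EW : ℝ := Real.sqrt ((1 / 8 * Real.exp (-(3 * κ)))⁻¹ * (2 * (1 + 1 / (2 * r - κ))) ^ 3) * D₀ with hEWdef
  have hEW0 : 0 ≤ EW := by positivity
  have hEW : ∀ p₁, Real.sqrt (∑ p, c₀ * ‖WL2.equiv ℂ _ W₂ u p‖ ^ 2 / W p₁ p) ≤ EW * Real.exp (-(κ₁ * d p₁)) := by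
    intro p₁
    have h2r : κ < 2 * r := by linarith
    exact sqrt_sum_normSq_div_weight_le_of_blockDecay (n := n) u (W p₁) (iterBlockOf (K - n) ((bondEquiv F K).symm p₁).src) v
      hκ0.le (by positivity) hD₀ h2r (hfloor p₁) hD
  have hS7 : ∑ l ∈ Finset.range 3, (1 / lam) ^ l ≤ 7 := sum_range_three_inv_pow_le hlam
  have hS0 : 0 ≤ ∑ l ∈ Finset.range 3, (1 / lam) ^ l := Finset.sum_nonneg fun l _ => by positivity
  have hCg_le : 8 * Real.exp (3 * κ) ≤ 8 * Real.exp (3 * r) := by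
    have := Real.exp_le_exp.mpr (by linarith : 3 * κ ≤ 3 * r); linarith
  have hSl : (∑ l ∈ Finset.range 3, (1 / lam) ^ l) / lam ≤ 14 := by
    rw [div_le_iff₀ hlam0]; nlinarith
  have hprod_le : θ * (8 * Real.exp (3 * κ)) * (∑ l ∈ Finset.range 3, (1 / lam) ^ l) / lam ≤ θ * (8 * Real.exp (3 * r)) * 14 := by
    rw [mul_div_assoc]
    exact mul_le_mul (mul_le_mul_of_nonneg_left hCg_le hθ) hSl (by positivity) (by positivity)
  have hsmall' : θ * (8 * Real.exp (3 * κ)) * (∑ l ∈ Finset.range 3, (1 / lam) ^ l) / lam < 1 := hprod_le.trans_lt hsmall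
  have hO4 := pointwiseDecay_oneForm_of_letters (h := h) (cB := cB) (a := a) (Δx := Δx) hnK U₀ hu hq d κ₁ W hlam0 hWpos hsup hW1
    (by positivity : (0 : ℝ) ≤ 8 * Real.exp (3 * κ)) hWd hFsrc hsD hθ hEW0 hf' hqdom hEW hsmall' p₀
  refine hO4.trans (mul_le_mul_of_nonneg_right ?_ (Real.exp_pos _).le)
  have hden : 0 < 1 - θ * (8 * Real.exp (3 * r)) * 14 := by linarith
  have hden' : 1 - θ * (8 * Real.exp (3 * r)) * 14 ≤ 1 - θ * (8 * Real.exp (3 * κ)) * (∑ l ∈ Finset.range 3, (1 / lam) ^ l) / lam := by linarith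
  have hnum1 : (Fsrc + sD) * (8 * Real.exp (3 * κ)) * (∑ l ∈ Finset.range 3, (1 / lam) ^ l) / lam ≤ (Fsrc + sD) * (8 * Real.exp (3 * r)) * 14 := by
    rw [mul_div_assoc]
    exact mul_le_mul (mul_le_mul_of_nonneg_left hCg_le (by positivity)) hSl (by positivity) (by positivity)
  have hC₃ : Real.sqrt (3 ^ 3 / (c₀ * ((F.L : ℝ) ^ (K - n)) ^ 3) * (lam ^ 3)⁻¹) ≤ Real.sqrt (3 ^ 3 * 8 / (c₀ * ((F.L : ℝ) ^ (K - n)) ^ 3)) := by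
    refine Real.sqrt_le_sqrt ?_
    have hL : 0 < c₀ * ((F.L : ℝ) ^ (K - n)) ^ 3 := by
      have : (0 : ℝ) < (F.L : ℝ) ^ (K - n) := pow_pos (by exact_mod_cast (F.P K).L_pos) _
      positivity
    have hl3 : (lam ^ 3)⁻¹ ≤ 8 := by
      rw [inv_le_comm₀ (by positivity) (by norm_num)]
      nlinarith [pow_le_pow_left₀ (by norm_num : (0 : ℝ) ≤ 1 / 2) hlam 3]
    calc 3 ^ 3 / (c₀ * ((F.L : ℝ) ^ (K - n)) ^ 3) * (lam ^ 3)⁻¹ ≤ 3 ^ 3 / (c₀ * ((F.L : ℝ) ^ (K - n)) ^ 3) * 8 :=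
          mul_le_mul_of_nonneg_left hl3 (by positivity)
      _ = 3 ^ 3 * 8 / (c₀ * ((F.L : ℝ) ^ (K - n)) ^ 3) := by ring
  have hEWle : EW ≤ Real.sqrt (8 * Real.exp (3 * r) * (2 * (1 + 1 / r)) ^ 3) * D₀ := by
    rw [hEWdef]
    refine mul_le_mul_of_nonneg_right (Real.sqrt_le_sqrt ?_) hD₀
    have h8 : (1 / 8 * Real.exp (-(3 * κ)))⁻¹ = 8 * Real.exp (3 * κ) := by
      rw [mul_inv, Real.exp_neg, inv_inv]; norm_num
    rw [h8]
    have hrat : 1 / (2 * r - κ) ≤ 1 / r := one_div_le_one_div_of_le hr (by linarith)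
    have h2rκ : 0 < 2 * r - κ := by linarith
    have hb0 : 0 ≤ 2 * (1 + 1 / (2 * r - κ)) := mul_nonneg zero_le_two (add_nonneg zero_le_one (div_nonneg zero_le_one h2rκ.le))
    have hb : (2 * (1 + 1 / (2 * r - κ))) ^ 3 ≤ (2 * (1 + 1 / r)) ^ 3 := pow_le_pow_left₀ hb0 (by linarith) 3
    exact mul_le_mul hCg_le hb (pow_nonneg hb0 3) (by positivity)
  have hnum2 : Real.sqrt (3 ^ 3 / (c₀ * ((F.L : ℝ) ^ (K - n)) ^ 3) * (lam ^ 3)⁻¹) * EW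
      ≤ Real.sqrt (3 ^ 3 * 8 / (c₀ * ((F.L : ℝ) ^ (K - n)) ^ 3)) * (Real.sqrt (8 * Real.exp (3 * r) * (2 * (1 + 1 / r)) ^ 3) * D₀) :=
    mul_le_mul hC₃ hEWle hEW0 (Real.sqrt_nonneg _)
  have hnum0 : 0 ≤ (Fsrc + sD) * (8 * Real.exp (3 * κ)) * (∑ l ∈ Finset.range 3, (1 / lam) ^ l) / lam
      + Real.sqrt (3 ^ 3 / (c₀ * ((F.L : ℝ) ^ (K - n)) ^ 3) * (lam ^ 3)⁻¹) * EW := by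
    refine add_nonneg ?_ (mul_nonneg (Real.sqrt_nonneg _) hEW0)
    rw [mul_div_assoc]
    exact mul_nonneg (mul_nonneg (add_nonneg hFsrc hsD) (by positivity)) (div_nonneg hS0 hlam0.le)
  exact div_le_div₀ (by linarith [hnum0, hnum1, hnum2]) (add_le_add hnum1 hnum2) hden hden'


/-! ## §2 O4-E2E at the explicit rate -/

/-- ★★★ **THE POINTWISE DECAY OF `Δ_a(U₀)⁻¹` AT THE SLOT OF RECORD, EXPLICIT RATE.**  ✓`pointwiseDecay_oneForm_DeltaEtaSlot`'s letters (`RegPr`, block-supported bounded source,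
A4-shape block decay `hD` at rate `r > 0`, kernel rows `hkD`∕`hkQ` at rate `μ′ > r`, `(32√2ε₀e^{5r})(8e^{3r})·14 < 1`) ⟹ `∀ p₀, ‖u(p₀)‖ ≤ A·e^{−(min r (1∕4)∕2)·tdist(B(p₀), v)}` — NO `∃`.
Re-derivation of ★p1 g26's proof over §1; `hqdom` at the one rate by ✓`hqdom_of_letters`. [cite: Balaban1985BackgroundPropagators, Thm 3.1 (3.42) p.397, (3.46) p.398, (3.49) p.399, Thm 3.12 p.422] -/
theorem pointwiseDecay_oneForm_DeltaEtaSlot_rate (hnK : n ≤ K) {ε₀ : ℝ} (hε₀ : 0 ≤ ε₀) (U₀ : GaugeField (F.P K) 0 (Matrix.specialUnitaryGroup (Fin 2) ℂ)) (hreg : RegPr F n K ε₀ U₀)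
    {u f : BondL2K ℂ 3 (periodsT3 F K) c₀ W₂} (hu : laplaceA F n K h c₀ cB a (DeltaEtaSlot F n K c₀) U₀ u = f)
    (v : Site (F.P K) (K - n)) {Fsrc : ℝ} (hfb : ∀ p, ‖WL2.equiv ℂ _ W₂ f p‖ ≤ Fsrc)
    (hfs : ∀ p, WL2.equiv ℂ _ W₂ f p ≠ 0 → iterBlockOf (K - n) ((bondEquiv F K).symm p).src = v)
    {r D₀ : ℝ} (hr : 0 < r) (hD₀ : 0 ≤ D₀)
    (hD : ∀ y : Site (F.P K) (K - n),
      ‖toL2 F K c₀ (fun b => if iterBlockOf (K - n) b.src = y then (toL2 F K c₀).symm u b else 0)‖ ≤ D₀ * Real.exp (-(r * (Site.tdist y v : ℝ))))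
    {CkD CkQ μ' : ℝ} (hCkD : 0 ≤ CkD) (hCkQ : 0 ≤ CkQ) (hrμ : r < μ')
    (hkD : ∀ (b : PBond (F.P K) 0) (Z : Matrix (Fin 2) (Fin 2) ℂ) (bd : PBond (F.P K) 0),
      ‖(toL2 F K c₀).symm (DL2 F n K c₀ U₀ (DstarL2 F n K c₀ U₀ (toL2 F K c₀ (Pi.single b Z)) - RS F n K h c₀ cB U₀ (DstarL2 F n K c₀ U₀ (toL2 F K c₀ (Pi.single b Z))))) bd‖
        ≤ CkD * Real.exp (-(μ' * (Site.tdist (P := F.P K) (iterBlockOf (K - n) b.src) (iterBlockOf (K - n) bd.src) : ℝ))) * ‖Z‖)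
    (hkQ : ∀ (b : PBond (F.P K) 0) (Z : Matrix (Fin 2) (Fin 2) ℂ) (bd : PBond (F.P K) 0),
      ‖(toL2 F K c₀).symm (LinearMap.adjoint (Qk F n K h c₀ cB U₀) (((a : ℝ) : ℂ) • Qk F n K h c₀ cB U₀ (toL2 F K c₀ (Pi.single b Z)))) bd‖
        ≤ CkQ * Real.exp (-(μ' * (Site.tdist (P := F.P K) (iterBlockOf (K - n) b.src) (iterBlockOf (K - n) bd.src) : ℝ))) * ‖Z‖)
    (hsmall : (32 * Real.sqrt 2 * ε₀ * Real.exp (5 * r)) * (8 * Real.exp (3 * r)) * 14 < 1) (p₀ : Bond 3 (periodsT3 F K)) :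
    ‖WL2.equiv ℂ _ W₂ u p₀‖
      ≤ (((Fsrc + Real.sqrt 2 * ((CkQ + CkD) * Real.sqrt (((F.P K).d : ℝ) * ((((F.P K).L : ℝ) ^ (F.P K).d) ^ (K - n)) / c₀) * D₀ * (2 * (1 + 1 / (μ' - r))) ^ 3))
              * (8 * Real.exp (3 * r)) * 14
            + Real.sqrt (3 ^ 3 * 8 / (c₀ * ((F.L : ℝ) ^ (K - n)) ^ 3)) * (Real.sqrt (8 * Real.exp (3 * r) * (2 * (1 + 1 / r)) ^ 3) * D₀))
          / (1 - (32 * Real.sqrt 2 * ε₀ * Real.exp (5 * r)) * (8 * Real.exp (3 * r)) * 14))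
        * Real.exp (-((min r (1 / 4) / 2) * (Site.tdist (iterBlockOf (K - n) ((bondEquiv F K).symm p₀).src) v : ℝ))) := by
  set BD : BondL2K ℂ 3 (periodsT3 F K) c₀ W₂ →ₗ[ℂ] BondL2K ℂ 3 (periodsT3 F K) c₀ W₂ :=
    DL2 F n K c₀ U₀ ∘ₗ (LinearMap.id - RS F n K h c₀ cB U₀) ∘ₗ DstarL2 F n K c₀ U₀ with hBD
  have hBDv : ∀ w, BD w = DL2 F n K c₀ U₀ (DstarL2 F n K c₀ U₀ w - RS F n K h c₀ cB U₀ (DstarL2 F n K c₀ U₀ w)) := fun w => by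
    simp only [hBD, LinearMap.comp_apply, LinearMap.sub_apply, LinearMap.id_apply]
  set BQ : BondL2K ℂ 3 (periodsT3 F K) c₀ W₂ →ₗ[ℂ] BondL2K ℂ 3 (periodsT3 F K) c₀ W₂ :=
    LinearMap.adjoint (Qk F n K h c₀ cB U₀) ∘ₗ (((a : ℝ) : ℂ) • Qk F n K h c₀ cB U₀) with hBQ
  have hBQv : ∀ w, BQ w = LinearMap.adjoint (Qk F n K h c₀ cB U₀) (((a : ℝ) : ℂ) • Qk F n K h c₀ cB U₀ w) := fun w => by
    simp only [hBQ, LinearMap.comp_apply, LinearMap.smul_apply]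
  have hkD' : ∀ (b : PBond (F.P K) 0) (Z : Matrix (Fin 2) (Fin 2) ℂ) (bd : PBond (F.P K) 0), ‖(toL2 F K c₀).symm (BD (toL2 F K c₀ (Pi.single b Z))) bd‖
      ≤ CkD * Real.exp (-(μ' * (Site.tdist (P := F.P K) (iterBlockOf (K - n) b.src) (iterBlockOf (K - n) bd.src) : ℝ))) * ‖Z‖ := fun b Z bd => by
    rw [hBDv]; exact hkD b Z bd
  have hkQ' : ∀ (b : PBond (F.P K) 0) (Z : Matrix (Fin 2) (Fin 2) ℂ) (bd : PBond (F.P K) 0), ‖(toL2 F K c₀).symm (BQ (toL2 F K c₀ (Pi.single b Z))) bd‖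
      ≤ CkQ * Real.exp (-(μ' * (Site.tdist (P := F.P K) (iterBlockOf (K - n) b.src) (iterBlockOf (K - n) bd.src) : ℝ))) * ‖Z‖ := fun b Z bd => by
    rw [hBQv]; exact hkQ b Z bd
  set d : Bond 3 (periodsT3 F K) → ℝ := fun p => (Site.tdist (iterBlockOf (K - n) ((bondEquiv F K).symm p).src) v : ℝ) with hd
  set N : ℝ := Real.sqrt (((F.P K).d : ℝ) * ((((F.P K).L : ℝ) ^ (F.P K).d) ^ (K - n)) / c₀) with hN
  set Vr : ℝ := (2 * (1 + 1 / (μ' - r))) ^ 3 with hVr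
  have hμr : 0 < μ' - r := by linarith
  have hVr0 : 0 ≤ Vr := by rw [hVr]; positivity
  have hQ : ∀ p, ‖WL2.equiv ℂ _ W₂ (BQ u) p‖ ≤ Real.sqrt 2 * (CkQ * N * D₀ * Vr) * Real.exp (-(r * d p)) :=
    norm_equiv_apply_le_of_kernelRow_blockDecay (n := n) BQ hCkQ hkQ' u v hD₀ hr.le hrμ hD
  have hDp : ∀ p, ‖WL2.equiv ℂ _ W₂ (BD u) p‖ ≤ Real.sqrt 2 * (CkD * N * D₀ * Vr) * Real.exp (-(r * d p)) :=
    norm_equiv_apply_le_of_kernelRow_blockDecay (n := n) BD hCkD hkD' u v hD₀ hr.le hrμ hD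
  have hX0 : ∀ p, WL2.equiv ℂ _ W₂ ((DeltaEtaSlot F n K c₀ U₀
      - (DeltaEta F n K c₀ U₀ : BondL2K ℂ 3 (periodsT3 F K) c₀ W₂ →ₗ[ℂ] BondL2K ℂ 3 (periodsT3 F K) c₀ W₂)) u) p = 0 := fun p => by
    have : (DeltaEtaSlot F n K c₀ U₀ - (DeltaEta F n K c₀ U₀ : BondL2K ℂ 3 (periodsT3 F K) c₀ W₂ →ₗ[ℂ] BondL2K ℂ 3 (periodsT3 F K) c₀ W₂)) = 0 := sub_self _
    rw [this, LinearMap.zero_apply, WL2.equiv_zero]; rfl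
  set sD : ℝ := Real.sqrt 2 * ((CkQ + CkD) * N * D₀ * Vr) with hsD
  set θ : ℝ := 32 * Real.sqrt 2 * ε₀ * Real.exp (5 * r) with hθ
  set κ₁ : ℝ := min r (1 / 4) / 2 with hκ₁
  have hκ₁0 : 0 < κ₁ := by rw [hκ₁]; exact div_pos (lt_min hr (by norm_num)) two_pos
  have hκ₁r : κ₁ ≤ r := by rw [hκ₁]; linarith [min_le_left r (1 / 4), lt_min hr (by norm_num : (0:ℝ) < 1 / 4)]
  refine pointwiseDecay_oneForm_knit_rate (h := h) (cB := cB) (a := a) (Δx := DeltaEtaSlot F n K c₀) hnK U₀ hu (q := fun p =>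
      WL2.equiv ℂ _ W₂ (LinearMap.adjoint (Qk F n K h c₀ cB U₀) (((a : ℝ) : ℂ) • Qk F n K h c₀ cB U₀ u)) p
      - WL2.equiv ℂ _ W₂ (DL2 F n K c₀ U₀ (DstarL2 F n K c₀ U₀ u - RS F n K h c₀ cB U₀ (DstarL2 F n K c₀ U₀ u))) p
      + WL2.equiv ℂ _ W₂ ((DeltaEtaSlot F n K c₀ U₀ - (DeltaEta F n K c₀ U₀ : BondL2K ℂ 3 (periodsT3 F K) c₀ W₂ →ₗ[ℂ] BondL2K ℂ 3 (periodsT3 F K) c₀ W₂)) u) p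
      + frobEquiv.symm ((eta F n K)⁻¹ • (eta F n K)⁻¹ •
          (deltaPrimeOp (torusT (F.P K) 0) (fun ν x => bgUnits F K U₀ ⟨x, ν⟩) 1 (formComp ((toL2 F K c₀).symm u)) p.2 ((siteEquiv F K).symm p.1)
            - curvOp (torusT (F.P K) 0) (fun ν x => bgUnits F K U₀ ⟨x, ν⟩) (formComp ((toL2 F K c₀).symm u)) p.2 ((siteEquiv F K).symm p.1))))
    (fun _ => rfl) v hfb hfs hr hD₀ hD (sD := sD) (θ := θ) (by positivity) (by positivity) ?_ hsmall p₀
  intro p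
  haveI : Nonempty (Bond 3 (periodsT3 F K)) := ⟨p⟩
  have hS0 : 0 ≤ ⨆ p', ‖WL2.equiv ℂ _ W₂ u p'‖ * Real.exp (κ₁ * d p') :=
    le_trans (by positivity) (le_ciSup (f := fun p' => ‖WL2.equiv ℂ _ W₂ u p'‖ * Real.exp (κ₁ * d p')) (Set.finite_range _).bddAbove p)
  have hmono : ∀ p', Real.exp (-(r * d p')) ≤ Real.exp (-(κ₁ * d p')) := fun p' => by
    have : 0 ≤ d p' := Nat.cast_nonneg _
    exact Real.exp_le_exp.mpr (by nlinarith)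
  have h₁ : ∀ p', ‖WL2.equiv ℂ _ W₂ (LinearMap.adjoint (Qk F n K h c₀ cB U₀) (((a : ℝ) : ℂ) • Qk F n K h c₀ cB U₀ u)) p'‖
      ≤ (Real.sqrt 2 * (CkQ * N * D₀ * Vr) + 0 * ⨆ p'', ‖WL2.equiv ℂ _ W₂ u p''‖ * Real.exp (κ₁ * d p'')) * Real.exp (-(κ₁ * d p')) := fun p' => by
    rw [zero_mul, add_zero, ← hBQv]
    exact (hQ p').trans (mul_le_mul_of_nonneg_left (hmono p') (by positivity))
  have h₂ : ∀ p', ‖WL2.equiv ℂ _ W₂ (DL2 F n K c₀ U₀ (DstarL2 F n K c₀ U₀ u - RS F n K h c₀ cB U₀ (DstarL2 F n K c₀ U₀ u))) p'‖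
      ≤ (Real.sqrt 2 * (CkD * N * D₀ * Vr) + 0 * ⨆ p'', ‖WL2.equiv ℂ _ W₂ u p''‖ * Real.exp (κ₁ * d p'')) * Real.exp (-(κ₁ * d p')) := fun p' => by
    rw [zero_mul, add_zero, ← hBDv]
    exact (hDp p').trans (mul_le_mul_of_nonneg_left (hmono p') (by positivity))
  have h₃ : ∀ p', ‖WL2.equiv ℂ _ W₂ ((DeltaEtaSlot F n K c₀ U₀
      - (DeltaEta F n K c₀ U₀ : BondL2K ℂ 3 (periodsT3 F K) c₀ W₂ →ₗ[ℂ] BondL2K ℂ 3 (periodsT3 F K) c₀ W₂)) u) p'‖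
      ≤ (0 + 0 * ⨆ p'', ‖WL2.equiv ℂ _ W₂ u p''‖ * Real.exp (κ₁ * d p'')) * Real.exp (-(κ₁ * d p')) := fun p' => by
    rw [hX0, norm_zero]; simp
  have hk := hqdom_of_letters U₀ hreg u _ _ _ _ (fun p' => rfl) d (κ := κ₁) (r := 5) hκ₁0.le (blockDist_le_blockDist_add_five v) h₁ h₂ h₃ p
  refine hk.trans (mul_le_mul_of_nonneg_right ?_ (Real.exp_pos _).le)
  have hθκ : 32 * Real.sqrt 2 * ε₀ * Real.exp (κ₁ * 5) ≤ θ := by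
    rw [hθ]; exact mul_le_mul_of_nonneg_left (Real.exp_le_exp.mpr (by linarith)) (by positivity)
  have hs : Real.sqrt 2 * (CkQ * N * D₀ * Vr) + Real.sqrt 2 * (CkD * N * D₀ * Vr) + 0 = sD := by rw [hsD]; ring
  rw [hs, zero_add, zero_add, zero_add]
  exact add_le_add le_rfl (mul_le_mul_of_nonneg_right hθκ hS0)

/-! ## §3 (K2) at the explicit rate — O4e's `hk` text for `G₀` with the rate displayed -/

/-- ★★★ **THE KERNEL ROW OF `G₀ = Δ_a(U₀)⁻¹` AT `DeltaEtaSlot`, EXPLICIT RATE `min r (1∕4) ∕ 2`.**  Same letters as ✓`kernelRow_GT_DeltaEtaSlot` ((γ) `hco`, (C_V) `hVlow`, (θ_V-class) `hVconj`,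
`0 < Θ_r`, `hkD`, `hkQ`, `PosOnto`, `RegPr`, `(32√2ε₀e^{5r})(8e^{3r})·14 < 1`):
`∀ b Z bd, ‖toL2⁻¹(G₀(toL2 δ_bZ)) bd‖ ≤ (√2·A₁)·e^{−(min r (1∕4)∕2)·tdist(B b₋, B bd₋)}·‖Z‖`, `A₁` = §2's constant at `Fsrc := 1`, `D₀ := e^{6r}√c₀∕Θ_r` — §2 per source with
`Fsrc := ‖frobEquiv⁻¹Z‖`, `D₀ := e^{6r}√c₀‖frobEquiv⁻¹Z‖∕Θ_r` (A4b ✓`blockDecay_allBlocks_of_letters`, ✓`norm_toL2_pi_single`), homogeneity of the constant, `‖frobEquiv⁻¹Z‖ ≤ √2|Z|`.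
CONDITIONAL on every displayed letter. [cite: Balaban1985BackgroundPropagators, Thm 3.1 (3.42) p.397, (3.46) p.398, (3.49) p.399, Thm 3.12 p.422] -/
theorem kernelRow_GT_DeltaEtaSlot_rate (hnK : n ≤ K) {ε₀ : ℝ} (hε₀ : 0 ≤ ε₀) (U₀ : GaugeField (F.P K) 0 (Matrix.specialUnitaryGroup (Fin 2) ℂ)) (hreg : RegPr F n K ε₀ U₀)
    (hp : PosOnto F n K h c₀ cB a (DeltaEtaSlot F n K c₀) U₀)
    {r : ℝ} (hr : 0 < r) {γ CV θV ε : ℝ} (hε : 0 < ε) (hε1 : ε ≤ 1)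
    (hco : ∀ v : BondL2K ℂ 3 (periodsT3 F K) c₀ W₂, γ * ‖v‖ ^ 2 ≤ RCLike.re ⟪v, laplaceA F n K h c₀ cB a (DeltaEtaSlot F n K c₀) U₀ v⟫_ℂ)
    (hVlow : ∀ X : PBond (F.P K) 0 → Matrix (Fin 2) (Fin 2) ℂ,
      -(CV * ‖toL2 F K c₀ X‖ ^ 2) ≤ RCLike.re ⟪toL2 F K c₀ X, laplaceA F n K h c₀ cB a (DeltaEtaSlot F n K c₀) U₀ (toL2 F K c₀ X)⟫_ℂ
        - ∑ μ : Fin (F.P K).d, ‖DL2 F n K c₀ U₀ (toL2S F K c₀ (formComp X μ))‖ ^ 2)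
    (hVconj : ∀ φ : Site (F.P K) 0 → ℝ, (∀ x x' : Site (F.P K) 0, |φ x - φ x'| ≤ r * eta F n K * (Site.tdist x x' : ℝ)) →
      ∀ X : PBond (F.P K) 0 → Matrix (Fin 2) (Fin 2) ℂ,
      RCLike.re ⟪toL2 F K c₀ X, laplaceA F n K h c₀ cB a (DeltaEtaSlot F n K c₀) U₀ (toL2 F K c₀ X)⟫_ℂ
          - (∑ μ : Fin (F.P K).d, ‖DL2 F n K c₀ U₀ (toL2S F K c₀ (formComp X μ))‖ ^ 2) - θV * ‖toL2 F K c₀ X‖ ^ 2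
        ≤ RCLike.re ⟪toL2 F K c₀ (fun b => Real.exp (φ b.src) • X b), laplaceA F n K h c₀ cB a (DeltaEtaSlot F n K c₀) U₀ (toL2 F K c₀ (fun b => (Real.exp (φ b.src))⁻¹ • X b))⟫_ℂ
          - RCLike.re (∑ μ : Fin (F.P K).d, ⟪DL2 F n K c₀ U₀ (toL2S F K c₀ (formComp (fun b => Real.exp (φ b.src) • X b) μ)),
              DL2 F n K c₀ U₀ (toL2S F K c₀ (formComp (fun b => (Real.exp (φ b.src))⁻¹ • X b) μ))⟫_ℂ))
    (hΘ : 0 < (1 - ε) * γ - ε * CV - 3 * (r ^ 2 * Real.exp (2 * r)) * (1 + 1 / ε) - θV)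
    {CkD CkQ μ' : ℝ} (hCkD : 0 ≤ CkD) (hCkQ : 0 ≤ CkQ) (hrμ : r < μ')
    (hkD : ∀ (b : PBond (F.P K) 0) (Z : Matrix (Fin 2) (Fin 2) ℂ) (bd : PBond (F.P K) 0),
      ‖(toL2 F K c₀).symm (DL2 F n K c₀ U₀ (DstarL2 F n K c₀ U₀ (toL2 F K c₀ (Pi.single b Z))
          - RS F n K h c₀ cB U₀ (DstarL2 F n K c₀ U₀ (toL2 F K c₀ (Pi.single b Z))))) bd‖
        ≤ CkD * Real.exp (-(μ' * (Site.tdist (P := F.P K) (iterBlockOf (K - n) b.src) (iterBlockOf (K - n) bd.src) : ℝ))) * ‖Z‖)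
    (hkQ : ∀ (b : PBond (F.P K) 0) (Z : Matrix (Fin 2) (Fin 2) ℂ) (bd : PBond (F.P K) 0),
      ‖(toL2 F K c₀).symm (LinearMap.adjoint (Qk F n K h c₀ cB U₀) (((a : ℝ) : ℂ) • Qk F n K h c₀ cB U₀ (toL2 F K c₀ (Pi.single b Z)))) bd‖
        ≤ CkQ * Real.exp (-(μ' * (Site.tdist (P := F.P K) (iterBlockOf (K - n) b.src) (iterBlockOf (K - n) bd.src) : ℝ))) * ‖Z‖)
    (hsmall : (32 * Real.sqrt 2 * ε₀ * Real.exp (5 * r)) * (8 * Real.exp (3 * r)) * 14 < 1)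
    (b : PBond (F.P K) 0) (Z : Matrix (Fin 2) (Fin 2) ℂ) (bd : PBond (F.P K) 0) :
    ‖(toL2 F K c₀).symm (GT F n K h c₀ cB a (DeltaEtaSlot F n K c₀) U₀ (toL2 F K c₀ (Pi.single b Z))) bd‖
      ≤ Real.sqrt 2 *
          (((1 + Real.sqrt 2 * ((CkQ + CkD) * Real.sqrt (((F.P K).d : ℝ) * ((((F.P K).L : ℝ) ^ (F.P K).d) ^ (K - n)) / c₀) * (Real.exp (6 * r) * Real.sqrt c₀ / ((1 - ε) * γ - ε * CV - 3 * (r ^ 2 * Real.exp (2 * r)) * (1 + 1 / ε) - θV)) * (2 * (1 + 1 / (μ' - r))) ^ 3)) * (8 * Real.exp (3 * r)) * 14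
              + Real.sqrt (3 ^ 3 * 8 / (c₀ * ((F.L : ℝ) ^ (K - n)) ^ 3)) * (Real.sqrt (8 * Real.exp (3 * r) * (2 * (1 + 1 / r)) ^ 3) * (Real.exp (6 * r) * Real.sqrt c₀ / ((1 - ε) * γ - ε * CV - 3 * (r ^ 2 * Real.exp (2 * r)) * (1 + 1 / ε) - θV))))
            / (1 - (32 * Real.sqrt 2 * ε₀ * Real.exp (5 * r)) * (8 * Real.exp (3 * r)) * 14))
        * Real.exp (-((min r (1 / 4) / 2) * (Site.tdist (P := F.P K) (iterBlockOf (K - n) b.src) (iterBlockOf (K - n) bd.src) : ℝ))) * ‖Z‖ := by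
  classical
  have hc₀ : 0 < c₀ := Fact.out
  set Θ : ℝ := (1 - ε) * γ - ε * CV - 3 * (r ^ 2 * Real.exp (2 * r)) * (1 + 1 / ε) - θV with hΘdef
  set D₁ : ℝ := Real.exp (6 * r) * Real.sqrt c₀ / Θ with hD₁def
  have hD₁ : 0 ≤ D₁ := by rw [hD₁def]; exact div_nonneg (by positivity) hΘ.le
  set N : ℝ := Real.sqrt (((F.P K).d : ℝ) * ((((F.P K).L : ℝ) ^ (F.P K).d) ^ (K - n)) / c₀) with hN
  set Vr : ℝ := (2 * (1 + 1 / (μ' - r))) ^ 3 with hVr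
  set C₃ : ℝ := Real.sqrt (3 ^ 3 * 8 / (c₀ * ((F.L : ℝ) ^ (K - n)) ^ 3)) * Real.sqrt (8 * Real.exp (3 * r) * (2 * (1 + 1 / r)) ^ 3) with hC₃
  have hden : 0 < 1 - (32 * Real.sqrt 2 * ε₀ * Real.exp (5 * r)) * (8 * Real.exp (3 * r)) * 14 := by linarith
  have hμr : 0 < μ' - r := by linarith
  -- A4b's `Θ` dominates the K-free floor
  have hΘle : Θ ≤ (1 - ε) * γ - ε * CV - 3 * ((eta F n K)⁻¹) ^ 2 * (Real.exp (r * eta F n K) - 1) ^ 2 * (1 + 1 / ε) - θV := by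
    have h1 := eta_sq_exp_sub_one_sq_le F n K hr.le
    have h2 : 0 ≤ 1 + 1 / ε := by positivity
    have h3 : 3 * (((eta F n K)⁻¹) ^ 2 * (Real.exp (r * eta F n K) - 1) ^ 2) * (1 + 1 / ε) ≤ 3 * (r ^ 2 * Real.exp (2 * r)) * (1 + 1 / ε) :=
      mul_le_mul_of_nonneg_right (mul_le_mul_of_nonneg_left h1 (by norm_num)) h2
    rw [hΘdef]; linarith
  have hΘA : 0 ≤ (1 - ε) * γ - ε * CV - 3 * ((eta F n K)⁻¹) ^ 2 * (Real.exp (r * eta F n K) - 1) ^ 2 * (1 + 1 / ε) - θV := hΘ.le.trans hΘle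
  set s : ℝ := ‖(frobEquiv.symm Z : W₂)‖ with hsdef
  have hs0 : 0 ≤ s := norm_nonneg _
  have hs2 : s ≤ Real.sqrt 2 * ‖Z‖ := norm_frobEquiv_symm_le Z
  set f : BondL2K ℂ 3 (periodsT3 F K) c₀ W₂ := toL2 F K c₀ (Pi.single b Z) with hf
  set u : BondL2K ℂ 3 (periodsT3 F K) c₀ W₂ := GT F n K h c₀ cB a (DeltaEtaSlot F n K c₀) U₀ f with hu
  have hu' : laplaceA F n K h c₀ cB a (DeltaEtaSlot F n K c₀) U₀ u = f := laplaceA_GT hp f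
  set v : Site (F.P K) (K - n) := iterBlockOf (K - n) b.src with hv
  have hfb : ∀ p, ‖WL2.equiv ℂ _ W₂ f p‖ ≤ s := fun p => norm_equiv_toL2_pi_single_le b Z p
  have hfs : ∀ p, WL2.equiv ℂ _ W₂ f p ≠ 0 → iterBlockOf (K - n) ((bondEquiv F K).symm p).src = v := fun p hp0 =>
    iterBlockOf_eq_of_equiv_toL2_pi_single_ne_zero b Z p hp0
  have hXf : ∀ b' : PBond (F.P K) 0, (Pi.single b Z : PBond (F.P K) 0 → Matrix (Fin 2) (Fin 2) ℂ) b' ≠ 0 → iterBlockOf (K - n) b'.src = v := by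
    intro b' hb'
    by_cases hbb : b' = b
    · rw [hbb]
    · rw [Pi.single_eq_of_ne hbb] at hb'; exact absurd rfl hb'
  have hnf : ‖toL2 F K c₀ (Pi.single b Z)‖ = Real.sqrt c₀ * s := norm_toL2_pi_single b Z
  -- the `hD` letter by A4b, with `D₀ := D₁·s`
  have hD : ∀ y : Site (F.P K) (K - n),
      ‖toL2 F K c₀ (fun b' => if iterBlockOf (K - n) b'.src = y then (toL2 F K c₀).symm u b' else 0)‖ ≤ (D₁ * s) * Real.exp (-(r * (Site.tdist y v : ℝ))) := by
    intro y
    have hA4 := blockDecay_allBlocks_of_letters (h := h) (cB := cB) (a := a) (Δx := DeltaEtaSlot F n K c₀) hnK U₀ hr.le hε hε1 hco hVlow hVconj hΘA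
      (Pi.single b Z) v hXf u hu' y
    rw [hnf] at hA4
    have hnum : Θ * ‖toL2 F K c₀ (fun b' => if iterBlockOf (K - n) b'.src = y then (toL2 F K c₀).symm u b' else 0)‖
        ≤ Real.exp (6 * r) * Real.exp (-(r * (Site.tdist y v : ℝ))) * (Real.sqrt c₀ * s) :=
      (mul_le_mul_of_nonneg_right hΘle (norm_nonneg _)).trans hA4
    rw [← le_div_iff₀' hΘ] at hnum
    refine hnum.trans (le_of_eq ?_)
    rw [hD₁def]; ring
  have hE := pointwiseDecay_oneForm_DeltaEtaSlot_rate (h := h) (cB := cB) (a := a) hnK hε₀ U₀ hreg hu' v hfb hfs hr (by positivity : 0 ≤ D₁ * s) hD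
    hCkD hCkQ hrμ hkD hkQ hsmall (bondEquiv F K bd)
  rw [Equiv.symm_apply_apply] at hE
  rw [toL2_symm_apply]
  refine (norm_frobEquiv_le _).trans (hE.trans ?_)
  rw [tdist_comm (iterBlockOf (K - n) bd.src) v]
  -- homogeneity of the constant in `(Fsrc, D₀) = s·(1, D₁)` and `s ≤ √2|Z|`
  have hhom : ((s + Real.sqrt 2 * ((CkQ + CkD) * N * (D₁ * s) * Vr)) * (8 * Real.exp (3 * r)) * 14 + Real.sqrt (3 ^ 3 * 8 / (c₀ * ((F.L : ℝ) ^ (K - n)) ^ 3))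
        * (Real.sqrt (8 * Real.exp (3 * r) * (2 * (1 + 1 / r)) ^ 3) * (D₁ * s)))
        / (1 - (32 * Real.sqrt 2 * ε₀ * Real.exp (5 * r)) * (8 * Real.exp (3 * r)) * 14)
      = s * (((1 + Real.sqrt 2 * ((CkQ + CkD) * N * D₁ * Vr)) * (8 * Real.exp (3 * r)) * 14 + Real.sqrt (3 ^ 3 * 8 / (c₀ * ((F.L : ℝ) ^ (K - n)) ^ 3))
        * (Real.sqrt (8 * Real.exp (3 * r) * (2 * (1 + 1 / r)) ^ 3) * D₁))
        / (1 - (32 * Real.sqrt 2 * ε₀ * Real.exp (5 * r)) * (8 * Real.exp (3 * r)) * 14)) := by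
    rw [mul_div_assoc']; congr 1; ring
  rw [hhom]
  have hA₁ : 0 ≤ ((1 + Real.sqrt 2 * ((CkQ + CkD) * N * D₁ * Vr)) * (8 * Real.exp (3 * r)) * 14 + Real.sqrt (3 ^ 3 * 8 / (c₀ * ((F.L : ℝ) ^ (K - n)) ^ 3))
        * (Real.sqrt (8 * Real.exp (3 * r) * (2 * (1 + 1 / r)) ^ 3) * D₁))
        / (1 - (32 * Real.sqrt 2 * ε₀ * Real.exp (5 * r)) * (8 * Real.exp (3 * r)) * 14) := by
    have hVr0 : 0 ≤ Vr := by rw [hVr]; positivity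
    exact div_nonneg (by positivity) hden.le
  have hexp0 : 0 ≤ Real.exp (-((min r (1 / 4) / 2) * (Site.tdist (P := F.P K) v (iterBlockOf (K - n) bd.src) : ℝ))) := (Real.exp_pos _).le
  calc s * (((1 + Real.sqrt 2 * ((CkQ + CkD) * N * D₁ * Vr)) * (8 * Real.exp (3 * r)) * 14 + Real.sqrt (3 ^ 3 * 8 / (c₀ * ((F.L : ℝ) ^ (K - n)) ^ 3))
          * (Real.sqrt (8 * Real.exp (3 * r) * (2 * (1 + 1 / r)) ^ 3) * D₁))
          / (1 - (32 * Real.sqrt 2 * ε₀ * Real.exp (5 * r)) * (8 * Real.exp (3 * r)) * 14))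
        * Real.exp (-((min r (1 / 4) / 2) * (Site.tdist (P := F.P K) v (iterBlockOf (K - n) bd.src) : ℝ)))
      ≤ (Real.sqrt 2 * ‖Z‖) * (((1 + Real.sqrt 2 * ((CkQ + CkD) * N * D₁ * Vr)) * (8 * Real.exp (3 * r)) * 14 + Real.sqrt (3 ^ 3 * 8 / (c₀ * ((F.L : ℝ) ^ (K - n)) ^ 3))
          * (Real.sqrt (8 * Real.exp (3 * r) * (2 * (1 + 1 / r)) ^ 3) * D₁))
          / (1 - (32 * Real.sqrt 2 * ε₀ * Real.exp (5 * r)) * (8 * Real.exp (3 * r)) * 14))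
        * Real.exp (-((min r (1 / 4) / 2) * (Site.tdist (P := F.P K) v (iterBlockOf (K - n) bd.src) : ℝ))) :=
        mul_le_mul_of_nonneg_right (mul_le_mul_of_nonneg_right hs2 hA₁) hexp0
    _ = _ := by rw [hv]; ring

end Summit.QuantumFields.YangMills.Theorems.Prop7OneFormPointwiseDecayRate

end
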